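import Mathlib.NumberTheory.Padics.PadicVal.Basic
import Mathlib.Algebra.BigOperators.Finprod
import Mathlib.SetTheory.Cardinal.Finite
import HarnessLib

/-!
# Kottwitz 1992, §19: the total number of fixed points (typed skeleton)

R. E. Kottwitz, *Points on some Shimura varieties over finite fields*, J. Amer. Math. Soc. 5 (1992) 373–444
[Kottwitz1992], §19 «Total number of fixed points», pp. 440–442, displays (19.1)–(19.6) (held text
`paper:doi-10-2307-2152772`, pdf p00NN = printed p. 372+NN; quotations AS PRINTED, read on p0068–p0070), with the inputs it
quotes from §16 (p. 433–434) and §17 (Lemma 17.2, p. 435).  Carpet file of squad TK (cell `pub/hodgecm-mathlib`, seat TK-t08):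
STATEMENTS ONLY — no proof, no `sorry`, no axiom, no instance, no notation.  TYPED SKELETON in the sense of
`Literature/AlgebraicGeometry/Liu2021/AlbaneseUnitaryShimura.lean`: a hypothesis structure `FixedPointCountDatum` of BARE
CARRIERS naming exactly the objects §19 quantifies over, DEFINITIONS with body for the quantities §19 DEFINES (`T(j,f)`,
`T(A, λ, i)`, `T(γ₀; γ, δ)`, `n(γ₀; γ, δ)`, `c(γ₀; γ, δ)`), and predicates `def P (D : FixedPointCountDatum Λ) : Prop` for the
displayed CLAIMS (19.1)–(19.6); NOTHING IS ASSERTED (a consumer takes `(h : D.P)` for its own datum).  The sibling carpet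
`TripleImage.lean` (§18) types Lemma 18.1, which §19 uses at one point (the vanishing `n = 0 ⇒ T = 0`, p. 441).

THE PRINT.  (p. 440, p0068 L25–L45) «In this section we will combine the results of the previous sections, obtaining an
expression for the number of fixed points of the correspondence `Φ_𝔭^j ∘ f` of §16 and, more generally, for the sum
`T(j, f) := Σ_{x' ∈ Fix} tr(Φ_𝔭^j ∘ f; 𝓕_x)`, where `Fix` denotes the set of fixed points of `Φ_𝔭^j ∘ f`. We keep the notation
of §§14–18. In §16 we associated to each `x' ∈ Fix` a positive rational number `c` of the form `c₀p^r`, where `c₀` is a `p`-adic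
unit, and a `c`-polarized virtual `B`-abelian variety `(A, λ, i)` over `k_r` up to isogeny, satisfying the three conditions of
§14. Therefore `T(j, f)` can be decomposed as (19.1) `T(j, f) = Σ_c Σ_{(A,λ,i)} T(A, λ, i)`, where `c` runs through rational
numbers of the type mentioned above and `(A, λ, i)` runs through the isogeny classes of `c`-polarized virtual `B`-abelian
varieties over `k_r` satisfying the three conditions of §14 and where `T(A, λ, i) = Σ_{x'} tr(Φ_𝔭^j ∘ f; 𝓕_x)` with `x'` running
through those fixed points to which is associated `(A, λ, i)`.»  (p. 441, p0069 L1–L31) «In §14 we associated to each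
`(A, λ, i)` as above a triple `(γ₀; γ, δ)` satisfying the conditions of §2 of [K5] and having the property that
`α(γ₀; γ, δ) = 1` (Lemma 15.1). In §16 we calculated `T(A, λ, i)` in terms of `(γ₀; γ, δ)`, (19.2)
`T(A, λ, i) = vol(I(ℚ)\I(𝔸_f)) O_γ(f^p) TO_δ(φ_r) tr ξ(γ₀)`. Recall from the discussion at the end of §14 that `I` is the
inner form of `I₀ = G_{γ₀}` constructed from `(γ₀; γ, δ)` in §3 of [K5]. Since the expression in (19.2) depends only on
`(γ₀; γ, δ)`, we can denote it by `T(γ₀; γ, δ)`. Then (19.3) `T(j, f) = Σ_{(γ₀;γ,δ)} n(γ₀; γ, δ) T(γ₀; γ, δ)`, where the sum is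
taken over the equivalence classes (see Lemma 17.2) of triples `(γ₀; γ, δ)` satisfying the conditions of §2 of [K5] and having
the property that `α(γ₀; γ, δ) = 1`, and where `n(γ₀; γ, δ)` denotes the number of `c`-polarized (for some `c`) virtual abelian
varieties `(A, λ, i)` satisfying the three conditions of §14 such that `(A, λ, i) ↦ (γ₀; γ, δ)`. If `n(γ₀; γ, δ)` is nonzero,
then by Lemma 17.2 it is equal to `|ker¹(ℚ, I)|`, which by (4.2.2) of [K2] is also equal to `|ker¹(ℚ, I₀)|`. Therefore, if
`n(γ₀; γ, δ)` is nonzero, we have (19.4) `n(γ₀; γ, δ) T(γ₀; γ, δ) = |ker¹(ℚ, I₀)| T(γ₀; γ, δ)`. In fact (19.4) is valid even when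
`n(γ₀; γ, δ)` is `0`. What we must check is that `n(γ₀; γ, δ) = 0` implies `T(γ₀; γ, δ) = 0`. […] It follows from Lemma 18.1
that `n(γ₀; γ, δ)` is nonzero […].»  (p. 441, p0069 L32–L49) «Now consider the factor `|ker¹(ℚ, I₀)|` appearing in (19.4). In
both Cases A and C the map `ker¹(ℚ, Z) → ker¹(ℚ, G)` is surjective (see §7), where `Z` denotes the center of `G`. Therefore the
map `ker¹(ℚ, I₀) → ker¹(ℚ, G)` is surjective, and it follows easily from Lemmas 4.3.1 and 4.3.2 of [K2] that all the fibers of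
this map have the same cardinality. Therefore `|ker¹(ℚ, I₀)|` is the product of `|ker¹(ℚ, G)|` and
`|ker[ker¹(ℚ, I₀) → ker¹(ℚ, G)]|`. As in §3 of [K5] we define `c(γ₀; γ, δ)` to be the product of `vol(I(ℚ)\I(𝔸_f))` and
`|ker[ker¹(ℚ, I₀) → ker¹(ℚ, G)]|`.»  (p. 442, p0070 L5–L30) «Our final result is that `T(j, f)` is equal to (19.5)
`|ker¹(ℚ, G)| Σ_{(γ₀;γ,δ)} c(γ₀; γ, δ) O_γ(f^p) TO_δ(φ_r) tr ξ(γ₀)`, with `(γ₀; γ, δ)` running through all equivalence classes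
of triples satisfying the conditions of §2 of [K5] and having the property that `α(γ₀; γ, δ) = 1`. The functions `f^p` and
`φ_r` are the ones defined in §16. In §8 we saw that `S_{K^p}` is the disjoint union of `|ker¹(ℚ, G)|` copies of the canonical
model for the Shimura variety associated to the data `(G, h^{−1}, K^p)`. Therefore the analog of `T(j, f)` for a single copy
of the canonical model is (19.6) `Σ_{(γ₀;γ,δ)} c(γ₀; γ, δ) O_γ(f^p) TO_δ(φ_r) tr ξ(γ₀)`, which is the formula (3.1) of [K5],
except for the following point. In [K5] it is claimed that (19.6) is the value of `T(j, f)` for the Shimura variety associated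
to `(G, h, K^p)`; however, we have just seen that it should be `(G, h^{−1}, K^p)` rather than `(G, h, K^p)`. Of course this
mistake also affects the conclusion of [K5]: the right [statement to expect] is that the virtual representation of
`G(𝔸_f^p)` and `Gal(ℚ̄/E)` described in §10 of that paper be equal to the virtual representation `⊕_{i=0}^{2 dim S_K} (−1)^i H^i(S_K̄, 𝓕_λ)`
for the canonical model `S_K` for `(G, h^{−1}, K)` (rather than `(G, h, K)`).» (bracketed words ours)  (§16, p. 433, p0061 L3–L10: «the number of
fixed points `(A, λ, i, η̄)` for which `(A, λ, i)` is isogenous to `(A₀, λ₀, i₀)` is equal to `vol(I(ℚ)\I(𝔸_f)) O_γ(f^p) TO_δ(φ_r)`,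
where `f^p` is the characteristic function of `K^p g^{−1} K^p`, `φ_r` is the characteristic function of `K_r σ(a) K_r` [`K_r a K_r`],
and where the Haar measure on `G(𝔸_f^p)` (respectively, `G(L_r)`) […] is the one giving measure `1` to `K^p` (respectively,
`K_r`)»; p. 434, p0062 L3–L13: «the trace of the automorphism `β` induced by our correspondence at a fixed point `x'` is equal to
`tr ρ(γ)` […] also equal to `tr ξ(γ₀)`».)

COEFFICIENTS.  `T(j, f)` and the traces `tr ξ(γ₀)` live in the `λ`-adic coefficient field of the sheaf `𝓕` (§6); the volume
`vol(I(ℚ)\I(𝔸_f))` and the (twisted) orbital integrals of the characteristic functions `f^p`, `φ_r` for the measures normalised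
by `K^p`, `K_r` are rational numbers.  The skeleton takes an arbitrary field `Λ` (of characteristic zero in the application) for the former and `ℚ`
for the latter.  Sums over equivalence classes of triples are `finsum`s (the printed sums have finitely many nonzero terms:
`Fix` is finite).  HC_CM is proved only modulo the printed citations until rung 0 closes; this file discharges none of them.

## References
* [Kottwitz1992] R. E. Kottwitz, *Points on some Shimura varieties over finite fields*, J. Amer. Math. Soc. 5 (1992), §19
  pp. 440–442 ((19.1)–(19.6)); §16 pp. 429–434; §17 Lemma 17.2 p. 435; §18 Lemma 18.1 p. 437; §8; §7.
* [K5] = R. E. Kottwitz, *Shimura varieties and λ-adic representations*, Perspect. Math. 10 (1990) 161–209, §2, §3 (3.1), §10;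
  [K2] = R. E. Kottwitz, *Stable trace formula: cuspidal tempered terms*, Duke Math. J. 51 (1984), (4.2.2), Lemmas 4.3.1, 4.3.2
  — quoted by [Kottwitz1992], not read here.
-/

namespace Literature.NumberTheory.Kottwitz1992.TotalFixedPoints

universe u v

/-- **Carriers for §19** (notation of §§14–18).  `Λ` is the coefficient field of the `λ`-adic sheaf `𝓕` (§6).  Fields:
* `p`, `r` — the residue characteristic and `r = j·[k : 𝔽_p]` (`k_r = 𝔽_{p^r}`, §16 p. 429), with the hypotheses `p_prime`, `r_pos` (ED. 2);
* `Fix` — «the set of fixed points of `Φ_𝔭^j ∘ f`» on `S_{K^p}(k̄)` (§16), a finite set (`fix_finite`); `tr x' = tr(Φ_𝔭^j ∘ f; 𝓕_x)`,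
  the trace of the automorphism induced on the stalk of `𝓕` (§16 p. 433–434);
* `PolAV c` — the isogeny classes of `c`-polarized virtual `B`-abelian varieties `(A, λ, i)` over `k_r` up to isogeny satisfying
  the three conditions of §14; `clsOf x'` — the pair `(c, (A, λ, i))` associated to the fixed point `x'` in §16 (p. 429–430);
* `Triple` — the EQUIVALENCE CLASSES (Lemma 17.2: `γ₀`'s stably conjugate, `γ`'s conjugate, `δ`'s `σ`-conjugate) of triples
  `(γ₀; γ, δ)` satisfying the conditions of §2 of [K5]; `AlphaTrivial t` — «`α(γ₀; γ, δ) = 1`»; `tripleOf A` — the §14 map;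
* `vol t = vol(I(ℚ)\I(𝔸_f))` for the inner form `I` of `I₀ = G_{γ₀}` attached to `t` (end of §14; «depends only on `(γ₀; γ, δ)`»,
  p. 441), `orb t = O_γ(f^p)`, `torb t = TO_δ(φ_r)` (measures giving `K^p`, `K_r` measure `1`, §16 p. 433), `trXi t = tr ξ(γ₀)`;
* `Ker1G` — the finite pointed set `ker¹(ℚ, G)` with base point `baseG`; `Ker1I0 t` — `ker¹(ℚ, I₀)`, `I₀ = G_{γ₀}`; `toG t` — the
  map `ker¹(ℚ, I₀) → ker¹(ℚ, G)` (p. 441);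
* `Tcopy` — «the analog of `T(j, f)` for a single copy of the canonical model» of the Shimura variety of `(G, h^{−1}, K^p)`
  (p. 442; by §8, `S_{K^p}` is the disjoint union of `|ker¹(ℚ, G)|` such copies).
[cite: Kottwitz1992, §19 (pp. 440–442); §16 (pp. 429–434); §17 Lemma 17.2 (p. 435)] -/
structure FixedPointCountDatum (Λ : Type v) where
  /-- the prime `p` -/
  p : ℕ
  /-- `p` is prime (ED. 2: makes `padicValRat p` in `Eq19_1` meaningful; review advisory on ED. 1) -/
  p_prime : p.Prime
  /-- `k_r = 𝔽_{p^r}` -/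
  r : ℕ
  /-- `r = j·[k : 𝔽_p] ≥ 1` -/
  r_pos : 0 < r
  /-- fixed points of `Φ_𝔭^j ∘ f` -/
  Fix : Type u
  /-- `Fix` is finite -/
  fix_finite : Finite Fix
  /-- `tr(Φ_𝔭^j ∘ f; 𝓕_x)` at the fixed point `x'` -/
  tr : Fix → Λ
  /-- isogeny classes of `c`-polarized virtual `B`-abelian varieties over `k_r` satisfying the three conditions of §14 -/
  PolAV : ℚ → Type u
  /-- the `(c, (A, λ, i))` of a fixed point (§16) -/
  clsOf : Fix → (c : ℚ) × PolAV c
  /-- equivalence classes of triples `(γ₀; γ, δ)` satisfying the conditions of [K5] §2 -/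
  Triple : Type u
  /-- `α(γ₀; γ, δ) = 1` -/
  AlphaTrivial : Triple → Prop
  /-- the §14 map `(A, λ, i) ↦ (γ₀; γ, δ)` -/
  tripleOf : {c : ℚ} → PolAV c → Triple
  /-- `vol(I(ℚ)\I(𝔸_f))` -/
  vol : Triple → ℚ
  /-- `O_γ(f^p)` -/
  orb : Triple → ℚ
  /-- `TO_δ(φ_r)` -/
  torb : Triple → ℚ
  /-- `tr ξ(γ₀)` -/
  trXi : Triple → Λ
  /-- `ker¹(ℚ, G)` -/
  Ker1G : Type u
  /-- its base point (the trivial class) -/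
  baseG : Ker1G
  /-- `ker¹(ℚ, G)` is finite -/
  ker1G_finite : Finite Ker1G
  /-- `ker¹(ℚ, I₀)`, `I₀ = G_{γ₀}` -/
  Ker1I0 : Triple → Type u
  /-- `ker¹(ℚ, I₀)` is finite -/
  ker1I0_finite : ∀ t, Finite (Ker1I0 t)
  /-- `ker¹(ℚ, I₀) → ker¹(ℚ, G)` -/
  toG : (t : Triple) → Ker1I0 t → Ker1G
  /-- the analog of `T(j, f)` for one copy of the canonical model of `Sh(G, h⁻¹)_{K^p}` -/
  Tcopy : Λ

namespace FixedPointCountDatum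

variable {Λ : Type v} [Field Λ]

/-- **`T(j, f) := Σ_{x' ∈ Fix} tr(Φ_𝔭^j ∘ f; 𝓕_x)`** (p. 440). [cite: Kottwitz1992, §19 (p. 440)] -/
noncomputable def T (D : FixedPointCountDatum.{u, v} Λ) : Λ :=
  ∑ᶠ x : D.Fix, D.tr x

/-- **`T(A, λ, i) := Σ_{x'} tr(Φ_𝔭^j ∘ f; 𝓕_x)`**, «with `x'` running through those fixed points to which is associated `(A, λ, i)`»
(p. 440–441). [cite: Kottwitz1992, §19 (19.1) (pp. 440–441)] -/
noncomputable def TA (D : FixedPointCountDatum.{u, v} Λ) (A : (c : ℚ) × D.PolAV c) : Λ :=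
  ∑ᶠ (x : D.Fix) (_ : D.clsOf x = A), D.tr x

/-- **`T(γ₀; γ, δ) := vol(I(ℚ)\I(𝔸_f)) O_γ(f^p) TO_δ(φ_r) tr ξ(γ₀)`** — the right-hand side of (19.2), which «depends only on
`(γ₀; γ, δ)`» (p. 441). [cite: Kottwitz1992, §19 (19.2) (p. 441)] -/
def Ttriple (D : FixedPointCountDatum.{u, v} Λ) (t : D.Triple) : Λ :=
  ((D.vol t * D.orb t * D.torb t : ℚ) : Λ) * D.trXi t

/-- **`n(γ₀; γ, δ)`** := «the number of `c`-polarized (for some `c`) virtual abelian varieties `(A, λ, i)` satisfying the three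
conditions of §14 such that `(A, λ, i) ↦ (γ₀; γ, δ)`» (p. 441; isogeny classes, as in (19.1)); `Nat.card`, so `0` if that set
were infinite. [cite: Kottwitz1992, §19 (19.3) (p. 441)] -/
noncomputable def nCount (D : FixedPointCountDatum.{u, v} Λ) (t : D.Triple) : ℕ :=
  Nat.card {A : (c : ℚ) × D.PolAV c // D.tripleOf A.2 = t}

/-- The kernel `ker[ker¹(ℚ, I₀) → ker¹(ℚ, G)]` (p. 441): the fibre of `toG` over the base point. [cite: Kottwitz1992, §19 (p. 441)] -/
def kerToG (D : FixedPointCountDatum.{u, v} Λ) (t : D.Triple) : Type u :=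
  {x : D.Ker1I0 t // D.toG t x = D.baseG}

/-- **`c(γ₀; γ, δ) := vol(I(ℚ)\I(𝔸_f)) · |ker[ker¹(ℚ, I₀) → ker¹(ℚ, G)]|`** («As in §3 of [K5]», p. 441).
[cite: Kottwitz1992, §19 (p. 441)] -/
noncomputable def cConst (D : FixedPointCountDatum.{u, v} Λ) (t : D.Triple) : ℚ :=
  D.vol t * Nat.card (D.kerToG t)

/-- **[Kottwitz1992, (19.1)]** (p. 440), AS PRINTED: «In §16 we associated to each `x' ∈ Fix` a positive rational number `c` of the
form `c₀p^r`, where `c₀` is a `p`-adic unit, and a `c`-polarized virtual `B`-abelian variety `(A, λ, i)` […]. Therefore `T(j, f)`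
can be decomposed as `T(j, f) = Σ_c Σ_{(A,λ,i)} T(A, λ, i)`».  TYPED: every `c` that occurs is positive with `v_p(c) = r`, and
`T(j, f)` is the sum of the `T(A, λ, i)` over all pairs `(c, (A, λ, i))` (a `finsum`; given `fix_finite` the regrouping itself is
Mathlib's `finsum` calculus — the printed content is the association `clsOf` of §16; DERIVABLE: the second conjunct follows from the
definitions and `fix_finite`, so consumers should not count it as an independent cited input).  Nothing is asserted.
[cite: Kottwitz1992, §19 (19.1) (p. 440)] -/
def Eq19_1 (D : FixedPointCountDatum.{u, v} Λ) : Prop :=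
  (∀ x : D.Fix, 0 < (D.clsOf x).1 ∧ padicValRat D.p (D.clsOf x).1 = D.r) ∧
    D.T = ∑ᶠ A : (c : ℚ) × D.PolAV c, D.TA A

/-- **[Kottwitz1992, (19.2)]** (p. 441; = the count of §16, p. 433, times the trace `tr ξ(γ₀)`, p. 434), AS PRINTED: «In §16 we
calculated `T(A, λ, i)` in terms of `(γ₀; γ, δ)`, `T(A, λ, i) = vol(I(ℚ)\I(𝔸_f)) O_γ(f^p) TO_δ(φ_r) tr ξ(γ₀)`».  Nothing is asserted.
[cite: Kottwitz1992, §19 (19.2) (p. 441); §16 (pp. 433–434)] -/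
def Eq19_2 (D : FixedPointCountDatum.{u, v} Λ) : Prop :=
  ∀ A : (c : ℚ) × D.PolAV c, D.TA A = D.Ttriple (D.tripleOf A.2)

/-- The triple of every `(A, λ, i)` has `α(γ₀; γ, δ) = 1` — Lemma 15.1 as recalled on p. 441 («having the property that
`α(γ₀; γ, δ) = 1` (Lemma 15.1)»); it is what makes the sums (19.3), (19.5) run over classes with `α = 1`.  Nothing is asserted.
[cite: Kottwitz1992, §19 (p. 441); §15 Lemma 15.1 (p. 423)] -/
def AlphaTrivialOfPolAV (D : FixedPointCountDatum.{u, v} Λ) : Prop :=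
  ∀ A : (c : ℚ) × D.PolAV c, D.AlphaTrivial (D.tripleOf A.2)

/-- **[Kottwitz1992, (19.3)]** (p. 441), AS PRINTED: «`T(j, f) = Σ_{(γ₀;γ,δ)} n(γ₀; γ, δ) T(γ₀; γ, δ)`, where the sum is taken over
the equivalence classes (see Lemma 17.2) of triples `(γ₀; γ, δ)` satisfying the conditions of §2 of [K5] and having the property
that `α(γ₀; γ, δ) = 1`».  Nothing is asserted. [cite: Kottwitz1992, §19 (19.3) (p. 441)] -/
def Eq19_3 (D : FixedPointCountDatum.{u, v} Λ) : Prop :=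
  D.T = ∑ᶠ t : {t : D.Triple // D.AlphaTrivial t}, (D.nCount t.1 : Λ) * D.Ttriple t.1

/-- «If `n(γ₀; γ, δ)` is nonzero, then by Lemma 17.2 it is equal to `|ker¹(ℚ, I)|`, which by (4.2.2) of [K2] is also equal to
`|ker¹(ℚ, I₀)|`» (p. 441).  Nothing is asserted. [cite: Kottwitz1992, §19 (p. 441); §17 Lemma 17.2 (p. 435)] -/
def nCount_eq_card_ker1 (D : FixedPointCountDatum.{u, v} Λ) : Prop :=
  ∀ t : D.Triple, D.nCount t ≠ 0 → D.nCount t = Nat.card (D.Ker1I0 t)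

/-- «What we must check is that `n(γ₀; γ, δ) = 0` implies `T(γ₀; γ, δ) = 0`» (p. 441; proved there from Lemma 18.1: if
`T(γ₀; γ, δ) ≠ 0` then `c = (γ₀γ₀^*)^{−1}` is positive of the form `p^r c₀`, conditions (1), (2) of Lemma 18.1 hold and
`TO_δ(φ_r) ≠ 0` gives (3)), for classes with `α(γ₀; γ, δ) = 1`.  Nothing is asserted. [cite: Kottwitz1992, §19 (p. 441)] -/
def Ttriple_eq_zero_of_nCount_eq_zero (D : FixedPointCountDatum.{u, v} Λ) : Prop :=
  ∀ t : D.Triple, D.AlphaTrivial t → D.nCount t = 0 → D.Ttriple t = 0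

/-- **[Kottwitz1992, (19.4)]** (p. 441), AS PRINTED: «`n(γ₀; γ, δ) T(γ₀; γ, δ) = |ker¹(ℚ, I₀)| T(γ₀; γ, δ)`. In fact (19.4) is valid
even when `n(γ₀; γ, δ)` is `0`» (for the classes in the sum (19.3), i.e. with `α(γ₀; γ, δ) = 1`).  DERIVABLE from `nCount_eq_card_ker1` and
`Ttriple_eq_zero_of_nCount_eq_zero` — not an independent cited input.  Nothing is asserted. [cite: Kottwitz1992, §19 (19.4) (p. 441)] -/
def Eq19_4 (D : FixedPointCountDatum.{u, v} Λ) : Prop :=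
  ∀ t : D.Triple, D.AlphaTrivial t →
    (D.nCount t : Λ) * D.Ttriple t = (Nat.card (D.Ker1I0 t) : Λ) * D.Ttriple t

/-- «In both Cases A and C the map `ker¹(ℚ, Z) → ker¹(ℚ, G)` is surjective (see §7) […]. Therefore the map
`ker¹(ℚ, I₀) → ker¹(ℚ, G)` is surjective, and it follows easily from Lemmas 4.3.1 and 4.3.2 of [K2] that all the fibers of this
map have the same cardinality» (p. 441).  TYPED: `toG t` is surjective and all its fibres have the cardinality of the kernel.
Nothing is asserted. [cite: Kottwitz1992, §19 (p. 441); §7 (pp. 393–394)] -/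
def toG_surjective_fibres (D : FixedPointCountDatum.{u, v} Λ) : Prop :=
  ∀ t : D.Triple, Function.Surjective (D.toG t) ∧
    ∀ y : D.Ker1G, Nat.card {x : D.Ker1I0 t // D.toG t x = y} = Nat.card (D.kerToG t)

/-- «Therefore `|ker¹(ℚ, I₀)|` is the product of `|ker¹(ℚ, G)|` and `|ker[ker¹(ℚ, I₀) → ker¹(ℚ, G)]|`» (p. 441).  DERIVABLE from
`toG_surjective_fibres` and the finiteness carriers (fibre counting) — not an independent cited input.  Nothing is asserted.
[cite: Kottwitz1992, §19 (p. 441)] -/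
def card_ker1I0_eq (D : FixedPointCountDatum.{u, v} Λ) : Prop :=
  ∀ t : D.Triple, Nat.card (D.Ker1I0 t) = Nat.card D.Ker1G * Nat.card (D.kerToG t)

/-- **[Kottwitz1992, (19.5)] — the total number of fixed points** (p. 442), AS PRINTED: «Our final result is that `T(j, f)` is
equal to `|ker¹(ℚ, G)| Σ_{(γ₀;γ,δ)} c(γ₀; γ, δ) O_γ(f^p) TO_δ(φ_r) tr ξ(γ₀)`, with `(γ₀; γ, δ)` running through all equivalence
classes of triples satisfying the conditions of §2 of [K5] and having the property that `α(γ₀; γ, δ) = 1`. The functions `f^p`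
and `φ_r` are the ones defined in §16.»  DERIVABLE from (19.3), (19.4), `card_ker1I0_eq` and the definition of `cConst` (finsum algebra) —
the printed chain, typed; not an independent cited input.  Nothing is asserted. [cite: Kottwitz1992, §19 (19.5) (p. 442)] -/
def Eq19_5 (D : FixedPointCountDatum.{u, v} Λ) : Prop :=
  D.T = (Nat.card D.Ker1G : Λ) *
    ∑ᶠ t : {t : D.Triple // D.AlphaTrivial t}, ((D.cConst t.1 * D.orb t.1 * D.torb t.1 : ℚ) : Λ) * D.trXi t.1

/-- **[Kottwitz1992, (19.6)] — one copy of the canonical model** (p. 442), AS PRINTED: «In §8 we saw that `S_{K^p}` is the disjoint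
union of `|ker¹(ℚ, G)|` copies of the canonical model for the Shimura variety associated to the data `(G, h^{−1}, K^p)`.
Therefore the analog of `T(j, f)` for a single copy of the canonical model is `Σ_{(γ₀;γ,δ)} c(γ₀; γ, δ) O_γ(f^p) TO_δ(φ_r) tr ξ(γ₀)`,
which is the formula (3.1) of [K5], except for the following point. In [K5] it is claimed that (19.6) is the value of `T(j, f)`
for the Shimura variety associated to `(G, h, K^p)`; however, we have just seen that it should be `(G, h^{−1}, K^p)` rather than
`(G, h, K^p)`.»  TYPED for the carrier `Tcopy`; the ensuing correction to [K5] §10 (the alternating sum of `H^i(S_K̄, 𝓕_λ)` is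
to be taken for the canonical model of `(G, h^{−1}, K)`) is prose, not typed.  Nothing is asserted.
[cite: Kottwitz1992, §19 (19.6) (p. 442)] -/
def Eq19_6 (D : FixedPointCountDatum.{u, v} Λ) : Prop :=
  D.T = (Nat.card D.Ker1G : Λ) * D.Tcopy ∧
    D.Tcopy = ∑ᶠ t : {t : D.Triple // D.AlphaTrivial t}, ((D.cConst t.1 * D.orb t.1 * D.torb t.1 : ℚ) : Λ) * D.trXi t.1

end FixedPointCountDatum

end Literature.NumberTheory.Kottwitz1992.TotalFixedPoints
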